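import Summits.HubbardSuperconductivity.HubbardSuperconductivity.Theorems.AnisotropyChordTransferFibre3FinX3Eval

/-!
# Route `AnisotropyChord` / H0 rotor rung: FIN per-`L` GM₃ (X5), `L = 28` — rows `N₁` / D / side-condition cell facts, part `p32`

Kernel facts (`decide +kernel`) for cert cells 83, 84 of the per-`L` grid of `L = 28`: `xbnCellAny2` (row `N₁` on XB2 point wedges recomputed in the kernel, exporting the literal brackets `nt ⊇ T⁺ − 3λ₂` and `tb ⊇ T⁺·D`), `xdCellAnyN0` (row D, reads `nt`), `sdCellAnyZN` (side condition, reads `nt`); evaluators `…FinX3Eval` / `…FinX5Eval`; constants from the compiled design probe (x3probe/x3plan, margins c ×0.985, b ×1.03, aD ×1.03); assembled in `…FinX5GM3TwentyEight`.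
Prover seat `hubbard-h0-rotor-p3` g8; helper for piece A = stmt-HubbardSuperconductivity-23918 of rung 19089 (`--supports`, helper class).
WHAT THIS IS NOT: nothing here proves superconductivity in the Hubbard model (rotor TARGET as worded stays FALSE, g15 verdict); kernel facts for the FIN certificate of ONE conditional reduction.  Tree imports only; zero data; standard axioms.
-/

set_option linter.dupNamespace false
set_option autoImplicit false

namespace Summit.HubbardSuperconductivity.HubbardSuperconductivity.Theorems.AnisotropyChord.Transfer.Fibre3

namespace FinXD

open FinXB FinCell Hole2

set_option maxHeartbeats 4000000 in
/-- row `N₁` of cell 83 of `L = 28` (`c = 121/200`), exporting `nt`, `tb`. [folklore] -/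
theorem xn28_83 : xbnCellAny2 28 (49/50 : ℚ) 528885869971046 542108016720323 (121/200 : ℚ) ((-708928549695 : ℤ), (4076243677200 : ℤ)) ((1585938997173929 : ℤ), (1630409978027683 : ℤ)) = true := by decide +kernel

set_option maxHeartbeats 4000000 in
/-- row D of cell 83 of `L = 28` (`aD = 41/500`). [folklore] -/
theorem xd28_83 : xdCellAnyN0 28 (49/50 : ℚ) 528885869971046 542108016720323 (41/500 : ℚ) ((-708928549695 : ℤ), (4076243677200 : ℤ)) = true := by decide +kernel

set_option maxHeartbeats 4000000 in
/-- side condition of cell 83 of `L = 28` (`c, b = 69/100, aD`). [folklore] -/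
theorem sd28_83 : sdCellAnyZN 28 (49/50 : ℚ) 100 528885869971046 542108016720323 ((121/200 : ℚ), (69 : ℕ), (41/500 : ℚ)) ((-708928549695 : ℤ), (4076243677200 : ℤ)) = true := by decide +kernel

set_option maxHeartbeats 4000000 in
/-- row `N₁` of cell 84 of `L = 28` (`c = 121/200`), exporting `nt`, `tb`. [folklore] -/
theorem xn28_84 : xbnCellAny2 28 (49/50 : ℚ) 542108016720323 555660717138332 (121/200 : ℚ) ((-591522303323 : ℤ), (4197508593981 : ℤ)) ((1625722601563395 : ℤ), (1671189586303228 : ℤ)) = true := by decide +kernel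

set_option maxHeartbeats 4000000 in
/-- row D of cell 84 of `L = 28` (`aD = 41/500`). [folklore] -/
theorem xd28_84 : xdCellAnyN0 28 (49/50 : ℚ) 542108016720323 555660717138332 (41/500 : ℚ) ((-591522303323 : ℤ), (4197508593981 : ℤ)) = true := by decide +kernel

set_option maxHeartbeats 4000000 in
/-- side condition of cell 84 of `L = 28` (`c, b = 69/100, aD`). [folklore] -/
theorem sd28_84 : sdCellAnyZN 28 (49/50 : ℚ) 100 542108016720323 555660717138332 ((121/200 : ℚ), (69 : ℕ), (41/500 : ℚ)) ((-591522303323 : ℤ), (4197508593981 : ℤ)) = true := by decide +kernel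

end FinXD

end Summit.HubbardSuperconductivity.HubbardSuperconductivity.Theorems.AnisotropyChord.Transfer.Fibre3
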